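/-
Copyright: statement-level skeleton of a published paper (lit-balaban cell, reader/typer r15; Phase-2 seat p33 taken by the
nominating reader). No proof claims beyond what the kernel checks below.
-/
import Literature.MathematicalPhysics.QuantumFieldTheory.BalabanImbrieJaffe1984to88.BIJ85CellAverages

/-!
# BIJ85 — T. Bałaban, J. Imbrie, A. Jaffe, *Renormalization of the Higgs model: minimizers, propagators and the
stability of mean field theory*, CMP **97** (1985) 299–329, Sect. 2 (2.5)–(2.8): parallel transport along contours and the
gauge covariance of the block average

statement-level skeleton of published theorems with citation tags; proofs where landed; nothing here is a claim about
the Yang–Mills mass gap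

Source: held text `paper:balaban1985-cmp97-bij-higgs-minimizers`; render of p. 303 [PDF 5] read as an image
(`pub-balaban/t4/b2b-balaban-t4-lit2/renders/bij1985/1985-cmp97-bij-higgs-minimizers-p005-x2.png`), p. 302 [PDF 4] (own render).
Rows C1.Eq2.5, C1.Eq2.8 of `HOME/lit-balaban-r15/ROWS-C1.md`; Phase-2 envelope seat p33 (PHASE2-TARGETS.md §G.3: "(Qφ)^h = Qφ^h
over a contour carrier — holonomy of a gauge-transformed field telescopes").

* **(2.5)** p. 302, verbatim: *"Let Γ denote a path (contour) composed of bonds, and define u(Γ) = Π_{b∈Γ} u_b. (2.5) Contours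
  Γ₁, Γ₂ can be composed if the endpoint of Γ₂ coincides with the starting point of Γ₁, so u(Γ₁∘Γ₂) = u(Γ₁)u(Γ₂)."* — a contour
  as the list of the sites it visits, `hol u Γ` the ordered product of the step variables `u x x′` (for the lattice:
  `u x x′ = u_b` if (x, x′) = (b₋, b₊) and `u_b^{−1}` for the reversed bond, p. 300 "u_b^{−1} = u_{b^{−1}}"); `hol_append`
  (u(Γ₁∘Γ₂) = u(Γ₁)u(Γ₂), PROVED).
* **(2.7)–(2.8)** p. 303: under u ↦ u^h, u^h(x, x′) = h(x)u(x, x′)h(x′)^{−1}, the transport along ANY contour from y to x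
  telescopes: u^h(Γ_{yx}) = h(y)u(Γ_{yx})h(x)^{−1} (`hol_gauge`, PROVED in every group); consequently the hypothesis `hτ` of
  `BIJ85CellAverages.Cells.Qcov_gauge` holds for transports DEFINED as contour holonomies, and **(2.8)** *"(Qφ)^h = Qφ^h"* is
  PROVED for the average (2.6) built from any system of contours Γ_{yx} running from the corner of B(y) to x
  (`Qcov_hol_gauge`).
-/

namespace Literature.MathematicalPhysics.QuantumFieldTheory.BalabanImbrieJaffe1984to88.BIJ85ContourHolonomy

open BIJ85CellAverages

section Holonomy

variable {V G : Type*} [Group G]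

/-- **(2.5)** p. 302 [PDF 4]: *"define u(Γ) = Π_{b∈Γ} u_b"* — the ordered product of the step variables along a contour given
as the list of sites it visits (x₀, x₁, …, x_n): u(x₀,x₁)u(x₁,x₂)⋯u(x_{n−1},x_n); the empty and one-site contours carry 1.
[cite: BalabanImbrieJaffe1985, (2.5) p.302] -/
def hol (u : V → V → G) : List V → G
  | [] => 1
  | [_] => 1
  | x :: y :: rest => u x y * hol u (y :: rest)

/-- kernel: unfolding on a contour with at least one step. [cite: BalabanImbrieJaffe1985, (2.5) p.302] -/
@[simp] theorem hol_cons_cons (u : V → V → G) (x y : V) (rest : List V) :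
    hol u (x :: y :: rest) = u x y * hol u (y :: rest) := rfl

/-- kernel: a one-site contour carries 1. [cite: BalabanImbrieJaffe1985, (2.5) p.302] -/
@[simp] theorem hol_singleton (u : V → V → G) (x : V) : hol u [x] = 1 := rfl

/-- kernel: the empty contour carries 1. [cite: BalabanImbrieJaffe1985, (2.5) p.302] -/
@[simp] theorem hol_nil (u : V → V → G) : hol u ([] : List V) = 1 := rfl

/-- **(2.5)**, composition: *"Contours Γ₁, Γ₂ can be composed if the endpoint of Γ₂ coincides with the starting point of Γ₁, so
u(Γ₁∘Γ₂) = u(Γ₁)u(Γ₂)"* — for site lists: the contour x₀…x_n followed by x_n…x_m (sharing the site x_n) carries the product.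
PROVED. [cite: BalabanImbrieJaffe1985, (2.5) p.302] -/
theorem hol_append (u : V → V → G) (l₁ : List V) (z : V) (l₂ : List V) :
    hol u (l₁ ++ z :: l₂) = hol u (l₁ ++ [z]) * hol u (z :: l₂) := by
  induction l₁ with
  | nil => simp
  | cons x rest ih =>
    cases rest with
    | nil => simp
    | cons y rest' =>
      simp only [List.cons_append] at ih ⊢
      rw [hol_cons_cons, hol_cons_cons, ih, mul_assoc]

/-- **(2.7)** acting on the step variables: u^h(x, x′) = h(x)u(x, x′)h(x′)^{−1} (*"u_b → h(b₋)h(b₊)^{−1}u_b = u^h_b"*, written for a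
general group; for U(1) the order is immaterial). [cite: BalabanImbrieJaffe1985, (2.7) p.303] -/
def gaugeStep (h : V → G) (u : V → V → G) : V → V → G := fun x y => h x * u x y * (h y)⁻¹

/-- The telescoping behind **(2.8)**: along any contour x₀ … x_n, u^h(Γ) = h(x₀)u(Γ)h(x_n)^{−1}.  PROVED (any group).
[cite: BalabanImbrieJaffe1985, (2.8) p.303] -/
theorem hol_gauge (h : V → G) (u : V → V → G) (x : V) (l : List V) :
    hol (gaugeStep h u) (x :: l) = h x * hol u (x :: l) * (h ((x :: l).getLast (List.cons_ne_nil x l)))⁻¹ := by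
  induction l generalizing x with
  | nil => simp [hol]
  | cons y rest ih =>
    rw [hol_cons_cons, hol_cons_cons, ih y]
    have hlast : (x :: y :: rest).getLast (List.cons_ne_nil x (y :: rest)) =
        (y :: rest).getLast (List.cons_ne_nil y rest) := List.getLast_cons_cons
    rw [hlast]
    simp only [gaugeStep]
    group

end Holonomy

/-! ### (2.8) for the block average built from contour holonomies -/

section Average

variable (Gc : Cells) {V : Type*}

/-- The transports of (2.6) DEFINED as contour holonomies: τ_x = u(Γ_x), with `Γ x` the standard contour attached to the fine
cell x (from the corner of its block to x, p. 302–303), the sites `V` of the unit lattice, and `u` the U(1) step variables.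
[cite: BalabanImbrieJaffe1985, (2.6) p.303] -/
noncomputable def holTransport (Γ : Gc.F → List V) (u : V → V → Circle) (x : Gc.F) : Circle := hol u (Γ x)

/-- **(2.8)** p. 303 [PDF 5], verbatim: *"An important property of the average is that Q commutes with gauge transformations. …
Clearly (Qφ)^h = Qφ^h. (2.8)"* — PROVED for the covariant average (2.6) (`Cells.Qcov`) whose transports are the holonomies
u(Γ_{yx}) along contours Γ_x that START at the corner site `corner y` of the block B(y) ∋ x and END at the site `pt x` of x:
Q_{u^h}(h·φ)(y) = h(corner y)·(Q_uφ)(y).  The geometry (which contour, which corner) is the instance's; only its two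
endpoint facts are used. [cite: BalabanImbrieJaffe1985, (2.8) p.303] -/
theorem Qcov_hol_gauge (Γ : Gc.F → List V) (pt : Gc.F → V) (corner : Gc.C → V)
    (hne : ∀ x, Γ x ≠ [])
    (hhead : ∀ (y : Gc.C) (x : Gc.F), x ∈ Gc.B y → (Γ x).head (hne x) = corner y)
    (hlast : ∀ x, (Γ x).getLast (hne x) = pt x)
    (u : V → V → Circle) (h : V → Circle) (φ : Gc.F → ℂ) (y : Gc.C) :
    Gc.Qcov (holTransport Gc Γ (gaugeStep h u)) (fun x => (h (pt x) : ℂ) * φ x) y =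
      (h (corner y) : ℂ) * Gc.Qcov (holTransport Gc Γ u) φ y := by
  refine Gc.Qcov_gauge (holTransport Gc Γ u) (holTransport Gc Γ (gaugeStep h u)) (fun x => h (pt x))
    (fun y => h (corner y)) ?_ φ y
  intro y x hx
  unfold holTransport
  obtain ⟨x0, l, hl⟩ : ∃ x0 l, Γ x = x0 :: l := List.exists_cons_of_ne_nil (hne x)
  have hx0 : x0 = corner y := by
    have := hhead y x hx
    simp only [hl, List.head_cons] at this
    exact this
  have hL : (x0 :: l).getLast (List.cons_ne_nil x0 l) = pt x := by
    have := hlast x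
    simp only [hl] at this
    exact this
  rw [hl, hol_gauge, hL, hx0]

end Average

end Literature.MathematicalPhysics.QuantumFieldTheory.BalabanImbrieJaffe1984to88.BIJ85ContourHolonomy
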